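import Summits.RiemannHypothesis.RiemannHypothesis.Theorems.WeilFormatCDataO94ColTables
import Summits.RiemannHypothesis.RiemannHypothesis.Theorems.S2FormatCE0
import Literature.NumberTheory.LFunctions.YoshidaWindowGramTailMSSines
import Literature.NumberTheory.LFunctions.YoshidaWindowGramMiddleJBox
import Literature.NumberTheory.LFunctions.YoshidaWindowGramTailJFactoredScaled
import Literature.NumberTheory.LFunctions.YoshidaWindowGramTailMSFactored
import Literature.NumberTheory.LFunctions.YoshidaWindowGramTailJDiagTight
import Summits.RiemannHypothesis.RiemannHypothesis.Theorems.FormatCPsdBands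
import Summits.RiemannHypothesis.RiemannHypothesis.Theorems.WeilFormatCDiagShift
import HarnessLib

/-!
# Format C kernel rung `O94` (a = 47/50, column-band layout): light-table slices 820…880 (kernel certificates)

Window `a = 47/50`; prime powers in the window: 2, 3, 2^2, 5; prime constant A = 1825/1000 (`WeilFormatC.primeCoeff_form_ge_cells_09729`); evaluator parameters S = 2^256, Kpi 130, Kser 150, kred 8, Kexp 45, J 120; full table modes < 161; light column table modes < 1027; units 2^-250 (Schur entries), 2^-124 (column digits, width 127), 2^-118 (tail-factor digits, width 121), 2^-64 (reciprocal weights), 2^-40 (tail base); order-J tail J = 4, θ = 1/2048, η = 1/10 | 4/1.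
Design row: sr-gb-rung-a odd λ-run (parity cell 10 L-side): a = 47/50, μ = 2^-75, odd 160/320/1024, MS tail; see HOME(A)/LADDER-LSIDES-FORMATC-A-g22.md. Generated by sr-gb-rung-a prover A g22 with rh-explicit-weil-2 gen7's generator extended for the odd λ-run (--sector odd --mu-log2; HOME(A)/code-g22/gen7/gramgen7.py sha16 172ee47dc0b1c923) from `#eval` of the tree's `Encl` functions; every datum is re-verified by the kernel in the theorem files (`decide +kernel`). Helper data of the rh-explicit Weil-positivity programme (format C, K-CELL-2), RH-free. [cite: Yoshida1992HermitianForms, §5 (5.15)-(5.16) p. 301; §7 pp. 305–312]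
-/

set_option linter.dupNamespace false
set_option maxRecDepth 200000

namespace Summit.RiemannHypothesis.RiemannHypothesis.Theorems.WeilFormatCData.O94
open Literature.NumberTheory.LFunctions Literature.NumberTheory.LFunctions.Yoshida1992 Encl Literature.Analysis.ValidatedNumerics.NumericsMP

/-- kernel: light-table slice `[820, 830)`. -/
theorem tC820 : checkTableCol O94.prm O94.C O94.ctab 820 10 = true := by decide +kernel

/-- kernel: light-table slice `[830, 840)`. -/
theorem tC830 : checkTableCol O94.prm O94.C O94.ctab 830 10 = true := by decide +kernel

/-- kernel: light-table slice `[840, 850)`. -/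
theorem tC840 : checkTableCol O94.prm O94.C O94.ctab 840 10 = true := by decide +kernel

/-- kernel: light-table slice `[850, 860)`. -/
theorem tC850 : checkTableCol O94.prm O94.C O94.ctab 850 10 = true := by decide +kernel

/-- kernel: light-table slice `[860, 870)`. -/
theorem tC860 : checkTableCol O94.prm O94.C O94.ctab 860 10 = true := by decide +kernel

/-- kernel: light-table slice `[870, 880)`. -/
theorem tC870 : checkTableCol O94.prm O94.C O94.ctab 870 10 = true := by decide +kernel

end Summit.RiemannHypothesis.RiemannHypothesis.Theorems.WeilFormatCData.O94
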